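import Literature.Computability.QuantumComplexity.StabilizerRankPermanentAdvice
import Literature.Computability.QuantumComplexity.StabilizerRankPermanent
import Literature.Computability.Complexity.PPolyTuringClosure
import Literature.Computability.Complexity.CodeFPBudgets
import Literature.Computability.Complexity.LengthCompare
import Literature.Computability.Complexity.CHCounting
import Literature.Computability.Complexity.StockmeyerEstimator
import HarnessLib

/-!
# Discharge of Mehraban–Tahmasbi 2024, Thm. 1.6: polynomial exact rank of `|T⟩^{⊗m}` puts `P^{#P}` in `P/poly`

Topic `Literature/Computability/QuantumComplexity`; the last file of the discharge of the named fact
`MehrabanTahmasbi2024_PSharpP_subset_PPoly_of_stabilizerRank_poly` (`StabilizerRankPermanent.lean`;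
S. Mehraban, M. Tahmasbi, STOC 2024 = arXiv:2305.10277, Thm. 1.6 with Remark 1.7):

  `(∃ c, ∀ m, χ(|T⟩^{⊗m}) ≤ m^c + c) → P^{#P} ⊆ P/poly`.

The mathematics of the advice is `SharpPHT.Core.advice_spec` (`StabilizerRankPermanentAdvice.lean`):
for the Hadamard-test core `Q` of a `#P` relation and every length `n` an advice datum `advOf Q n` of
polynomial code length which EVALUATES (`AdvDatum.eval`: the exact Clifford amplitude evaluator
`ampValOf` of `CliffordAmplitudeFP.lean` on each item, then an integer formula) to the witness count of
every query of length `n`. Here: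

* `ℤ[ω]` arithmetic in integer coordinates `T4 = (ℤ × ℤ) × (ℤ × ℤ)` (`zoT`, `mul4`, `sum4` with
  `zoT_mul`, `zoT_list_sum`) and on codes (`mul4_codeFP`, `sum4_codeFP`, via the Gaussian-pair bricks
  `zgMul_codeFP`, `zgAdd_codeFP`, `intSum`); the advice datum read in coordinates (`adv4Of`, the same
  strings: `advE_eq`, `adv4Of_codeFP`);
* **`SharpPHT.eval_codeFP`** — `AdvDatum.eval` is computed on codes by a polynomial-time string
  function (typed `CodeFP` lemmas: the task of an item `task4_codeFP`, the `map` of `ampVal_codeFP`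
  over the items `vals4_codeFP`, the closed formula `formula4_codeFP`, and `formula4_eq`:
  on the exact values the formula IS `AdvDatum.countOf`);
* **`SharpPHT.machineFn_codeFP`** — the advice-taking machine: on `⟨z, table⟩` it reads entry
  `|fstP z|` of the table and outputs bit `|sndP z|` of its evaluation at `fstP z`;
* the discharge **`MehrabanTahmasbi2024_PSharpP_subset_PPoly_of_stabilizerRank_poly_holds`**:
  `bitLang f ∈ P/poly-advice = P/poly` (`PPoly_eq_polyAdvice_P_holds`) for every `f ∈ #P`, hence
  `P^f ⊆ P/poly` (`PRel_ofFun_subset_PPoly`) and `P^{#P} ⊆ P/poly`.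

## References

* S. Mehraban, M. Tahmasbi, *Quadratic lower bounds on the approximate stabilizer rank: a
  probabilistic approach*, STOC 2024, arXiv:2305.10277, Thm. 1.6, its proof (p. 5–6) and Remark 1.7.
* S. Arora, B. Barak, *Computational Complexity: A Modern Approach*, CUP 2009, Def. 6.16–Thm. 6.18
  (`P/poly` = polynomial advice), §17.2 (`#P`, `P^{#P}`).
-/

noncomputable section

namespace Literature.Computability.QuantumComplexity

namespace SharpPHT

open _root_.Computability Cryptography Complexity Literature.Computability.Complexity.CodeFP BravyiGosset StabilizerFormalism
  Polynomial

/-! ### `ℤ[ω]` arithmetic in coordinates -/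

/-- Coordinate quadruples `((p.re, p.im), (q.re, q.im))`. [folklore] -/
abbrev T4 : Type := (ℤ × ℤ) × (ℤ × ℤ)

/-- Coordinates of an element of `ℤ[ω]`. [folklore] -/
def zoT (x : ZOmega) : T4 := ((x.p.re, x.p.im), (x.q.re, x.q.im))

/-- The element of `ℤ[ω]` with the given coordinates. [folklore] -/
def ofZoT (t : T4) : ZOmega := ⟨⟨t.1.1, t.1.2⟩, ⟨t.2.1, t.2.2⟩⟩

/-- `ofZoT ∘ zoT = id`. [folklore] -/
@[simp] theorem ofZoT_zoT (x : ZOmega) : ofZoT (zoT x) = x := by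
  obtain ⟨⟨a, b⟩, ⟨c, d⟩⟩ := x; rfl

/-- `zoT ∘ ofZoT = id`. [folklore] -/
@[simp] theorem zoT_ofZoT (t : T4) : zoT (ofZoT t) = t := by
  obtain ⟨⟨a, b⟩, ⟨c, d⟩⟩ := t; rfl

/-- The code of a quadruple. [folklore] -/
abbrev t4E : T4 → List Bool := pairE zgE zgE

/-- `zoE = t4E ∘ zoT` (definitional). [folklore] -/
theorem zoE_eq (x : ZOmega) : zoE x = t4E (zoT x) := rfl

/-- Multiplication by `i` in coordinates. [folklore] -/
def zgI (w : ℤ × ℤ) : ℤ × ℤ := (-w.2, w.1)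

/-- `zgOf (i · p) = zgI (zgOf p)`. [folklore] -/
theorem zgOf_gi_mul (p : GaussianInt) : zgOf (ZOmega.gi * p) = zgI (zgOf p) := by
  simp [zgOf, zgI, Zsqrtd.re_mul, Zsqrtd.im_mul, ZOmega.gi]

/-- `zgI` on codes. [folklore] -/
theorem zgI_codeFP : CodeFP zgE zgE zgI := by exact ((intNeg.comp (snd intE intE)).pair (fst intE intE) :)

/-- **Multiplication of `ℤ[ω]` in coordinates**: `(p, q)(p', q') = (pp' + i qq', pq' + qp')`. [folklore] -/
def mul4 (s t : T4) : T4 := (zgAdd (zgMul s.1 t.1) (zgI (zgMul s.2 t.2)), zgAdd (zgMul s.1 t.2) (zgMul s.2 t.1))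

/-- `zoT` is multiplicative. [folklore] -/
theorem zoT_mul (x y : ZOmega) : zoT (x * y) = mul4 (zoT x) (zoT y) := by
  have e1 : (zoT (x * y)).1 = zgOf (x.p * y.p + ZOmega.gi * (x.q * y.q)) := rfl
  have e2 : (zoT (x * y)).2 = zgOf (x.p * y.q + x.q * y.p) := rfl
  apply Prod.ext
  · rw [e1, zgOf_add, zgOf_mul, zgOf_gi_mul, zgOf_mul]; rfl
  · rw [e2, zgOf_add, zgOf_mul, zgOf_mul]; rfl

/-- `mul4` on codes. [folklore] -/
theorem mul4_codeFP : CodeFP (pairE t4E t4E) t4E (fun u => mul4 u.1 u.2) := by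
  have s1 : CodeFP (pairE t4E t4E) zgE (fun u => u.1.1) := by exact ((fst t4E t4E).fst' :)
  have s2 : CodeFP (pairE t4E t4E) zgE (fun u => u.1.2) := by exact ((fst t4E t4E).snd' :)
  have t1 : CodeFP (pairE t4E t4E) zgE (fun u => u.2.1) := by exact ((snd t4E t4E).fst' :)
  have t2 : CodeFP (pairE t4E t4E) zgE (fun u => u.2.2) := by exact ((snd t4E t4E).snd' :)
  have m11 : CodeFP (pairE t4E t4E) zgE (fun u => zgMul u.1.1 u.2.1) := by exact (zgMul_codeFP.comp (s1.pair t1) :)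
  have m22 : CodeFP (pairE t4E t4E) zgE (fun u => zgI (zgMul u.1.2 u.2.2)) := by
    exact (zgI_codeFP.comp (zgMul_codeFP.comp (s2.pair t2)) :)
  have m12 : CodeFP (pairE t4E t4E) zgE (fun u => zgMul u.1.1 u.2.2) := by exact (zgMul_codeFP.comp (s1.pair t2) :)
  have m21 : CodeFP (pairE t4E t4E) zgE (fun u => zgMul u.1.2 u.2.1) := by exact (zgMul_codeFP.comp (s2.pair t1) :)
  have h1 : CodeFP (pairE t4E t4E) zgE (fun u => zgAdd (zgMul u.1.1 u.2.1) (zgI (zgMul u.1.2 u.2.2))) := by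
    exact (zgAdd_codeFP.comp (m11.pair m22) :)
  have h2 : CodeFP (pairE t4E t4E) zgE (fun u => zgAdd (zgMul u.1.1 u.2.2) (zgMul u.1.2 u.2.1)) := by
    exact (zgAdd_codeFP.comp (m12.pair m21) :)
  exact (h1.pair h2).congr fun _ => rfl

/-- A Gaussian coordinate pair as a quadruple (`q = 0`). [folklore] -/
def ofGauss4 (w : ℤ × ℤ) : T4 := (w, (0, 0))

/-- `ofGauss4 (zgOf g) = zoT (ofGauss g)`. [folklore] -/
theorem ofGauss4_zgOf (g : GaussianInt) : ofGauss4 (zgOf g) = zoT (ofGauss g) := rfl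

/-- `ofGauss4` on codes. [folklore] -/
theorem ofGauss4_codeFP : CodeFP zgE t4E ofGauss4 := by
  exact (((CodeFP.id zgE).pair (const zgE (eβ := zgE) ((0 : ℤ), (0 : ℤ)))).congr fun _ => rfl :)

/-- Componentwise sum of quadruples. [folklore] -/
def sum4 (l : List T4) : T4 :=
  (((l.map fun s => s.1.1).sum, (l.map fun s => s.1.2).sum), ((l.map fun s => s.2.1).sum, (l.map fun s => s.2.2).sum))

/-- The coordinates of a list sum are `sum4` of the coordinates. [folklore] -/
theorem zoT_list_sum (l : List ZOmega) : zoT l.sum = sum4 (l.map zoT) := by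
  induction l with
  | nil => rfl
  | cons x l ih =>
    rw [List.sum_cons, List.map_cons]
    have e : zoT (x + l.sum) = (((zoT x).1.1 + (zoT l.sum).1.1, (zoT x).1.2 + (zoT l.sum).1.2),
        ((zoT x).2.1 + (zoT l.sum).2.1, (zoT x).2.2 + (zoT l.sum).2.2)) := rfl
    rw [e, ih]
    simp [sum4]

/-- `sum4` on codes (four integer sums). [folklore] -/
theorem sum4_codeFP : CodeFP (rawE t4E) t4E sum4 := by
  have c1 : CodeFP t4E intE (fun s => s.1.1) := by exact ((fst zgE zgE).fst' :)
  have c2 : CodeFP t4E intE (fun s => s.1.2) := by exact ((fst zgE zgE).snd' :)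
  have c3 : CodeFP t4E intE (fun s => s.2.1) := by exact ((snd zgE zgE).fst' :)
  have c4 : CodeFP t4E intE (fun s => s.2.2) := by exact ((snd zgE zgE).snd' :)
  have s1 : CodeFP (rawE t4E) intE (fun l => (l.map fun s => s.1.1).sum) := by exact (intSum.comp (map₀ c1) :)
  have s2 : CodeFP (rawE t4E) intE (fun l => (l.map fun s => s.1.2).sum) := by exact (intSum.comp (map₀ c2) :)
  have s3 : CodeFP (rawE t4E) intE (fun l => (l.map fun s => s.2.1).sum) := by exact (intSum.comp (map₀ c3) :)
  have s4 : CodeFP (rawE t4E) intE (fun l => (l.map fun s => s.2.2).sum) := by exact (intSum.comp (map₀ c4) :)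
  exact ((s1.pair s2).pair (s3.pair s4)).congr fun _ => rfl

/-! ### Reading an advice datum (the coefficients as coordinate quadruples) -/

/-- Items with the coefficient in coordinates. [folklore] -/
abbrev Item4 : Type := List GateCode × (List Bool × T4)

/-- The code of such an item (the same strings as `itemE`). [folklore] -/
abbrev item4E : Item4 → List Bool := pairE (rawE gcE) (pairE bitsE t4E)

/-- An item with its coefficient in coordinates. [folklore] -/
def item4Of (it : List GateCode × (List Bool × ZOmega)) : Item4 := (it.1, (it.2.1, zoT it.2.2))

/-- `itemE it = item4E (item4Of it)` (definitional). [folklore] -/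
theorem itemE_eq (it : List GateCode × (List Bool × ZOmega)) : itemE it = item4E (item4Of it) := rfl

/-- The advice datum with all `ℤ[ω]` data in coordinates. [folklore] -/
abbrev Adv4 : Type := ℕ × List Bool × List Bool × List Item4 × T4 × T4 × ℤ × ℕ

/-- Its code (the same strings as `advE`). [folklore] -/
abbrev adv4E : Adv4 → List Bool :=
  pairE unE (pairE bitsE (pairE bitsE (pairE (rawE item4E) (pairE t4E (pairE t4E (pairE intE unE))))))

/-- The coordinate form of an advice datum. [folklore] -/
def adv4Of (a : Core.AdvDatum) : Adv4 :=
  (a.tail0, a.base, a.finTail, a.items.map item4Of, zoT a.mult, zoT a.coden, a.nrm, a.rho)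

/-- `rawE` through a pointwise identity of codes. [folklore] -/
theorem rawE_map_eq {α β : Type} (e : α → List Bool) (e' : β → List Bool) (g : α → β) (h : ∀ a, e a = e' (g a))
    (l : List α) : rawE e l = rawE e' (l.map g) := by
  rw [rawE, rawE, List.map_map]
  congr 1
  exact List.map_congr_left fun a _ => h a

/-- `advE a = adv4E (adv4Of a)`. [folklore] -/
theorem advE_eq (a : Core.AdvDatum) : advE a = adv4E (adv4Of a) := by
  unfold advE adv4Of
  simp only [pairE_apply]
  rw [rawE_map_eq itemE item4E item4Of itemE_eq]
  rfl

/-- Reading an advice datum in coordinates. [folklore] -/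
theorem adv4Of_codeFP : CodeFP advE adv4E adv4Of := transparent fun a => (advE_eq a).symm

section Machine

/-- Context of the evaluation: an advice datum and a query string. [folklore] -/
abbrev CtxE : Core.AdvDatum × List Bool → List Bool := pairE advE strE

/-- The coordinate form of the context. [folklore] -/
abbrev Ctx4E : Adv4 × List Bool → List Bool := pairE adv4E strE

/-- The amplitude task of an item (coordinate form): the coefficient is not used. [folklore] -/
def task4 (a : Adv4) (y : List Bool) (it : Item4) : AT :=
  (it.1, (y ++ List.replicate a.1 false ++ it.2.1, y ++ a.2.1 ++ a.2.2.1))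

/-- `task4` is `taskOf`. [folklore] -/
theorem task4_eq (a : Core.AdvDatum) (y : List Bool) (it : List GateCode × (List Bool × ZOmega)) :
    task4 (adv4Of a) y (item4Of it) = a.taskOf y it := rfl

/-- The task on codes. [folklore] -/
theorem task4_codeFP : CodeFP (pairE Ctx4E item4E) atE (fun u => task4 u.1.1 u.1.2 u.2) := by
  have hc : CodeFP (pairE Ctx4E item4E) Ctx4E (fun u => u.1) := fst Ctx4E item4E
  have ha : CodeFP (pairE Ctx4E item4E) adv4E (fun u => u.1.1) := by exact (hc.fst' :)
  have hit : CodeFP (pairE Ctx4E item4E) item4E (fun u => u.2) := snd Ctx4E item4E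
  have hg : CodeFP (pairE Ctx4E item4E) (rawE gcE) (fun u => u.2.1) := by exact (hit.fst' :)
  have hz : CodeFP (pairE Ctx4E item4E) bitsE (fun u => u.2.2.1) := by exact (hit.snd'.fst' :)
  have hy : CodeFP (pairE Ctx4E item4E) bitsE (fun u => u.1.2) := by exact (bitsOfStr.comp hc.snd' :)
  have ht0 : CodeFP (pairE Ctx4E item4E) unE (fun u => u.1.1.1) := by exact (ha.fst' :)
  have hbase : CodeFP (pairE Ctx4E item4E) bitsE (fun u => u.1.1.2.1) := by exact (ha.snd'.fst' :)
  have hftail : CodeFP (pairE Ctx4E item4E) bitsE (fun u => u.1.1.2.2.1) := by exact (ha.snd'.snd'.fst' :)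
  have hrep : CodeFP (pairE Ctx4E item4E) bitsE (fun u => List.replicate u.1.1.1 false) := by
    exact ((replicateOf bitE).comp ((const _ false).pair ht0) :)
  have hinit1 : CodeFP (pairE Ctx4E item4E) bitsE (fun u => u.1.2 ++ List.replicate u.1.1.1 false) := by
    exact ((rawAppend bitE).comp (hy.pair hrep) :)
  have hinit : CodeFP (pairE Ctx4E item4E) bitsE (fun u => u.1.2 ++ List.replicate u.1.1.1 false ++ u.2.2.1) := by
    exact ((rawAppend bitE).comp (hinit1.pair hz) :)
  have hfin1 : CodeFP (pairE Ctx4E item4E) bitsE (fun u => u.1.2 ++ u.1.1.2.1) := by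
    exact ((rawAppend bitE).comp (hy.pair hbase) :)
  have hfin : CodeFP (pairE Ctx4E item4E) bitsE (fun u => u.1.2 ++ u.1.1.2.1 ++ u.1.1.2.2.1) := by
    exact ((rawAppend bitE).comp (hfin1.pair hftail) :)
  exact (hg.pair (hinit.pair hfin)).congr fun _ => rfl

/-- **The list of exact term values** (coordinate pairs), one per item.
[cite: MehrabanTahmasbi2024, proof of Theorem 1.6] -/
def vals4 (a : Adv4) (y : List Bool) : List (ℤ × ℤ) := a.2.2.2.1.map fun it => zgOf (ampValOf (task4 a y it))

/-- The values are those of `AdvDatum.eval`. [folklore] -/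
theorem vals4_eq (a : Core.AdvDatum) (y : List Bool) :
    vals4 (adv4Of a) y = (a.items.map fun it => ampValOf (a.taskOf y it)).map zgOf := by
  unfold vals4
  rw [List.map_map]
  show (a.items.map item4Of).map _ = _
  rw [List.map_map]
  refine List.map_congr_left fun it _ => ?_
  show zgOf (ampValOf (task4 (adv4Of a) y (item4Of it))) = zgOf (ampValOf (a.taskOf y it))
  rw [task4_eq]

/-- The values on codes. [cite: MehrabanTahmasbi2024, proof of Theorem 1.6] -/
theorem vals4_codeFP : CodeFP Ctx4E (rawE zgE) (fun t => vals4 t.1 t.2) := by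
  have hG : CodeFP (pairE Ctx4E item4E) zgE (fun u => zgOf (ampValOf (task4 u.1.1 u.1.2 u.2))) := by
    exact (ampVal_codeFP.comp task4_codeFP :)
  have h := map (σ := Adv4 × List Bool) (eσ := Ctx4E) (eα := item4E) (eβ := zgE)
    (g := fun u => zgOf (ampValOf (task4 u.1.1 u.1.2 u.2))) hG
  have hitems : CodeFP Ctx4E (rawE item4E) (fun t => t.1.2.2.2.1) := by exact ((fst adv4E strE).snd'.snd'.snd'.fst' :)
  have h2 : CodeFP Ctx4E (rawE zgE) (fun t => t.1.2.2.2.1.map fun it => zgOf (ampValOf (task4 t.1 t.2 it))) := by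
    exact (h.comp ((CodeFP.id Ctx4E).pair hitems) :)
  exact h2.congr fun _ => rfl

/-- The terms `aᵢ · Eᵢ` in coordinates. [folklore] -/
def terms4 (items : List Item4) (E : List (ℤ × ℤ)) : List T4 :=
  List.zipWith (fun it e => mul4 it.2.2 (ofGauss4 e)) items E

/-- The terms are the coordinates of those of `countOf`. [folklore] -/
theorem terms4_eq (items : List (List GateCode × (List Bool × ZOmega))) (E : List GaussianInt) :
    terms4 (items.map item4Of) (E.map zgOf) = (List.zipWith (fun it e => it.2.2 * ofGauss e) items E).map zoT := by
  unfold terms4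
  rw [List.zipWith_map_left, List.zipWith_map_right, List.map_zipWith]
  refine congrFun (congrFun (congrArg _ (funext fun it => funext fun e => ?_)) _) _
  show mul4 (zoT it.2.2) (ofGauss4 (zgOf e)) = zoT (it.2.2 * ofGauss e)
  rw [ofGauss4_zgOf, ← zoT_mul]

/-- The terms on codes. [folklore] -/
theorem terms4_codeFP : CodeFP (pairE (rawE item4E) (rawE zgE)) (rawE t4E) (fun u => terms4 u.1 u.2) := by
  have hp : CodeFP (pairE unitE (pairE item4E zgE)) (pairE item4E zgE) (fun u => u.2) := snd unitE (pairE item4E zgE)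
  have hit : CodeFP (pairE unitE (pairE item4E zgE)) item4E (fun u => u.2.1) := by exact (hp.fst' :)
  have he : CodeFP (pairE unitE (pairE item4E zgE)) zgE (fun u => u.2.2) := by exact (hp.snd' :)
  have hc : CodeFP (pairE unitE (pairE item4E zgE)) t4E (fun u => u.2.1.2.2) := by exact (hit.snd'.snd' :)
  have ho : CodeFP (pairE unitE (pairE item4E zgE)) t4E (fun u => ofGauss4 u.2.2) := by exact (ofGauss4_codeFP.comp he :)
  have hg : CodeFP (pairE unitE (pairE item4E zgE)) t4E (fun u => mul4 u.2.1.2.2 (ofGauss4 u.2.2)) := by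
    exact (mul4_codeFP.comp (hc.pair ho) :)
  have h := zipWith (σ := Unit) (eσ := unitE) (eα := item4E) (eβ := zgE) (eγ := t4E)
    (g := fun u => mul4 u.2.1.2.2 (ofGauss4 u.2.2)) hg
  have h2 : CodeFP (pairE (rawE item4E) (rawE zgE)) (rawE t4E)
      (fun u => List.zipWith (fun it e => mul4 it.2.2 (ofGauss4 e)) u.1 u.2) := by
    exact (h.comp ((const _ ()).pair (CodeFP.id _)) :)
  exact h2.congr fun _ => rfl

/-- **The closed formula in coordinates**: `(2^ρ - ((Σ terms) · mult · coden).p.re / nrm) / 2`.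
[cite: MehrabanTahmasbi2024, proof of Theorem 1.6] -/
def formula4 (a : Adv4) (E : List (ℤ × ℤ)) : ℤ :=
  ((2 : ℤ) ^ a.2.2.2.2.2.2.2 - ((mul4 (mul4 (sum4 (terms4 a.2.2.2.1 E)) a.2.2.2.2.1) a.2.2.2.2.2.1).1.1 / a.2.2.2.2.2.2.1)) / 2

/-- On the values of the items the formula is `countOf`. [folklore] -/
theorem formula4_eq (a : Core.AdvDatum) (E : List GaussianInt) : formula4 (adv4Of a) (E.map zgOf) = a.countOf E := by
  unfold formula4 Core.AdvDatum.countOf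
  simp only [adv4Of]
  rw [terms4_eq, ← zoT_list_sum, ← zoT_mul, ← zoT_mul]
  rfl

/-- The formula on codes. [folklore] -/
theorem formula4_codeFP : CodeFP (pairE adv4E (rawE zgE)) intE (fun u => formula4 u.1 u.2) := by
  have ha : CodeFP (pairE adv4E (rawE zgE)) adv4E (fun u => u.1) := fst adv4E (rawE zgE)
  have hE : CodeFP (pairE adv4E (rawE zgE)) (rawE zgE) (fun u => u.2) := snd adv4E (rawE zgE)
  have h3 : CodeFP (pairE adv4E (rawE zgE)) (pairE (rawE item4E) (pairE t4E (pairE t4E (pairE intE unE))))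
      (fun u => u.1.2.2.2) := by exact (ha.snd'.snd'.snd' :)
  have hitems : CodeFP (pairE adv4E (rawE zgE)) (rawE item4E) (fun u => u.1.2.2.2.1) := by exact (h3.fst' :)
  have hmult : CodeFP (pairE adv4E (rawE zgE)) t4E (fun u => u.1.2.2.2.2.1) := by exact (h3.snd'.fst' :)
  have hcoden : CodeFP (pairE adv4E (rawE zgE)) t4E (fun u => u.1.2.2.2.2.2.1) := by exact (h3.snd'.snd'.fst' :)
  have hnrm : CodeFP (pairE adv4E (rawE zgE)) intE (fun u => u.1.2.2.2.2.2.2.1) := by exact (h3.snd'.snd'.snd'.fst' :)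
  have hrho : CodeFP (pairE adv4E (rawE zgE)) unE (fun u => u.1.2.2.2.2.2.2.2) := by exact (h3.snd'.snd'.snd'.snd' :)
  have hT : CodeFP (pairE adv4E (rawE zgE)) (rawE t4E) (fun u => terms4 u.1.2.2.2.1 u.2) := by
    exact (terms4_codeFP.comp (hitems.pair hE) :)
  have hS : CodeFP (pairE adv4E (rawE zgE)) t4E (fun u => sum4 (terms4 u.1.2.2.2.1 u.2)) := by exact (sum4_codeFP.comp hT :)
  have hX1 : CodeFP (pairE adv4E (rawE zgE)) t4E (fun u => mul4 (sum4 (terms4 u.1.2.2.2.1 u.2)) u.1.2.2.2.2.1) := by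
    exact (mul4_codeFP.comp (hS.pair hmult) :)
  have hX : CodeFP (pairE adv4E (rawE zgE)) t4E
      (fun u => mul4 (mul4 (sum4 (terms4 u.1.2.2.2.1 u.2)) u.1.2.2.2.2.1) u.1.2.2.2.2.2.1) := by
    exact (mul4_codeFP.comp (hX1.pair hcoden) :)
  have hg : CodeFP (pairE adv4E (rawE zgE)) intE
      (fun u => (mul4 (mul4 (sum4 (terms4 u.1.2.2.2.1 u.2)) u.1.2.2.2.2.1) u.1.2.2.2.2.2.1).1.1) := by exact (hX.fst'.fst' :)
  have hgap : CodeFP (pairE adv4E (rawE zgE)) intE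
      (fun u => (mul4 (mul4 (sum4 (terms4 u.1.2.2.2.1 u.2)) u.1.2.2.2.2.1) u.1.2.2.2.2.2.1).1.1 / u.1.2.2.2.2.2.2.1) := by
    exact (intEDiv.comp (hg.pair hnrm) :)
  have hpow : CodeFP (pairE adv4E (rawE zgE)) intE (fun u => (2 : ℤ) ^ u.1.2.2.2.2.2.2.2) := by
    exact (intPow.comp ((const _ (2 : ℤ)).pair hrho) :)
  have hsub : CodeFP (pairE adv4E (rawE zgE)) intE (fun u => (2 : ℤ) ^ u.1.2.2.2.2.2.2.2 -
      (mul4 (mul4 (sum4 (terms4 u.1.2.2.2.1 u.2)) u.1.2.2.2.2.1) u.1.2.2.2.2.2.1).1.1 / u.1.2.2.2.2.2.2.1) := by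
    exact (intSub.comp (hpow.pair hgap) :)
  have hres : CodeFP (pairE adv4E (rawE zgE)) intE (fun u => ((2 : ℤ) ^ u.1.2.2.2.2.2.2.2 -
      (mul4 (mul4 (sum4 (terms4 u.1.2.2.2.1 u.2)) u.1.2.2.2.2.1) u.1.2.2.2.2.2.1).1.1 / u.1.2.2.2.2.2.2.1) / 2) := by
    exact (intEDiv.comp (hsub.pair (const _ (2 : ℤ))) :)
  exact hres.congr fun _ => rfl

/-- **Evaluation of an advice datum at a query, on codes.** [cite: MehrabanTahmasbi2024, proof of Theorem 1.6] -/
theorem eval_codeFP : CodeFP CtxE intE (fun t => t.1.eval t.2) := by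
  have ha : CodeFP CtxE adv4E (fun t => adv4Of t.1) := by exact (adv4Of_codeFP.comp (fst advE strE) :)
  have h4 : CodeFP CtxE Ctx4E (fun t => (adv4Of t.1, t.2)) := by exact (ha.pair (snd advE strE) :)
  have hv : CodeFP CtxE (rawE zgE) (fun t => vals4 (adv4Of t.1) t.2) := by exact (vals4_codeFP.comp h4 :)
  have hf : CodeFP CtxE intE (fun t => formula4 (adv4Of t.1) (vals4 (adv4Of t.1) t.2)) := by
    exact (formula4_codeFP.comp (ha.pair hv) :)
  refine hf.congr fun t => ?_
  rw [vals4_eq, formula4_eq]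
  rfl

/-! ### The machine: query, bit position, advice table -/

/-- A default advice datum. [folklore] -/
def dflt : Core.AdvDatum := ⟨0, [], [], [], 0, 0, 0, 0⟩

/-- **The decision function of the advice-taking machine** on an input string `z` (encoding a query
`x = fstP z` and a bit position `|sndP z|`) and an advice table: bit `|sndP z|` of the evaluation of
entry `|fstP z|` of the table at `fstP z`. [cite: MehrabanTahmasbi2024, proof of Theorem 1.6] -/
def machineFn (w : List Bool × List Core.AdvDatum) : Bool :=
  decide (((w.2.getD (fstP w.1).length dflt).eval (fstP w.1)).toNat / 2 ^ (sndP w.1).length % 2 = 1)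

/-- The input code of the machine: `⟨z, table⟩`. [folklore] -/
abbrev InE : List Bool × List Core.AdvDatum → List Bool := pairE strE (rawE advE)

/-- **The decision function is computed on codes by a polynomial-time string function.**
[cite: MehrabanTahmasbi2024, proof of Theorem 1.6 ("a polynomial-time algorithm with polynomial advice")] -/
theorem machineFn_codeFP : CodeFP InE bitE machineFn := by
  have hz : CodeFP InE strE (fun w => w.1) := fst strE (rawE advE)
  have htab : CodeFP InE (rawE advE) (fun w => w.2) := snd strE (rawE advE)
  have hfst : CodeFP strE strE fstP := of_fn fstP fstP_mem_FP fun _ => rfl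
  have hsnd : CodeFP strE strE sndP := of_fn sndP sndP_mem_FP fun _ => rfl
  have hx : CodeFP InE strE (fun w => fstP w.1) := by exact (hfst.comp hz :)
  have hu : CodeFP InE strE (fun w => sndP w.1) := by exact (hsnd.comp hz :)
  have hn : CodeFP InE natE (fun w => (fstP w.1).length) := by exact (strNatLength.comp hx :)
  have ha : CodeFP InE advE (fun w => w.2.getD (fstP w.1).length dflt) := by
    exact ((rawGetOr advE).comp (htab.pair (hn.pair (const _ dflt))) :)
  have hv : CodeFP InE intE (fun w => (w.2.getD (fstP w.1).length dflt).eval (fstP w.1)) := by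
    exact (eval_codeFP.comp (ha.pair hx) :)
  have hvn : CodeFP InE natE (fun w => ((w.2.getD (fstP w.1).length dflt).eval (fstP w.1)).toNat) := by
    exact (intToNat.comp hv :)
  have hul : CodeFP InE unE (fun w => (sndP w.1).length) := by exact (strLength.comp hu :)
  have hpow : CodeFP InE natE (fun w => 2 ^ (sndP w.1).length) := by exact (natPow.comp ((const _ (2 : ℕ)).pair hul) :)
  have hdiv : CodeFP InE natE (fun w => ((w.2.getD (fstP w.1).length dflt).eval (fstP w.1)).toNat / 2 ^ (sndP w.1).length) := by
    exact (natDiv.comp (hvn.pair hpow) :)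
  have hq : CodeFP InE natE
      (fun w => ((w.2.getD (fstP w.1).length dflt).eval (fstP w.1)).toNat / 2 ^ (sndP w.1).length % 2) := by
    exact (natMod.comp (hdiv.pair (const _ (2 : ℕ))) :)
  have hdec : CodeFP InE bitE (fun w =>
      decide (((w.2.getD (fstP w.1).length dflt).eval (fstP w.1)).toNat / 2 ^ (sndP w.1).length % 2 = 1)) := by
    exact (natEq.comp (hq.pair (const _ (1 : ℕ))) :)
  exact hdec.congr fun _ => rfl

end Machine

end SharpPHT

/-! ### The discharge -/

open _root_.Computability Cryptography Complexity Literature.Computability.Complexity.CodeFP SharpPHT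

/-- **Discharge of `MehrabanTahmasbi2024_PSharpP_subset_PPoly_of_stabilizerRank_poly`** (Mehraban–
Tahmasbi, STOC 2024 = arXiv:2305.10277, Thm. 1.6 with Remark 1.7: "The exact rank of the magic state
`|T⟩^{⊗m}` is super-polynomial unless the permanent has polynomial circuits", the conclusion rendered
as `P^{#P} ⊆ P/poly`). Proof, following the printed one: let `f ∈ #P` with relation `R ∈ P` and
witness polynomial `p`, and `Q` the Hadamard-test core of `(R, p)` (`SharpPHadamardCore.lean`: one
Clifford+`T` amplitude equals `(1/√2)^{ρ+|S₂|} (2^ρ - 2 f(y))`). Under `χ(|T⟩^{⊗m}) ≤ m^c + c`,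
`SharpPHT.Core.advice_spec` (`StabilizerRankPermanentAdvice.lean`: gadgetization, minimal — hence
independent — stabilizer decomposition of `|T⟩^{⊗t}`, phase-exact gadget words of its states,
Cramer's rule over `ℤ[ω]`, strong Gottesman–Knill evaluation) supplies for every length `n` a datum of
polynomial size evaluating to `f(y)` on all `y` of length `n`; the table of these data up to `n` is
the advice, `SharpPHT.machineFn_codeFP` is the polynomial-time machine reading it, so the bit graph
`bitLang f` is in `P/poly-advice = P/poly` (`PPoly_eq_polyAdvice_P_holds`, Arora–Barak Thm. 6.18), whence
`P^f ⊆ P/poly` (`PRel_ofFun_subset_PPoly`) and `P^{#P} = ⋃_f P^f ⊆ P/poly`.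
[cite: MehrabanTahmasbi2024, Theorem 1.6 and Remark 1.7] -/
theorem MehrabanTahmasbi2024_PSharpP_subset_PPoly_of_stabilizerRank_poly_holds :
    MehrabanTahmasbi2024_PSharpP_subset_PPoly_of_stabilizerRank_poly := by
  rintro ⟨c, hχ⟩ L hL
  obtain ⟨f, hf, hLf⟩ := Set.mem_iUnion₂.1 hL
  obtain ⟨R, hR, p, hfR⟩ := hf
  obtain ⟨Q, hQR, hQp⟩ := SharpPHT.exists_core hR p
  -- `f < 2^{p + 1}`
  have hflt : ∀ x, f x < 2 ^ (p + 1).eval x.length := fun x => by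
    rw [hfR x, Polynomial.eval_add, Polynomial.eval_one, pow_succ]
    have := Stockmeyer.countWitnesses_le_two_pow R (p.eval x.length) x
    have : 0 < 2 ^ p.eval x.length := Nat.two_pow_pos _
    omega
  refine PRel_ofFun_subset_PPoly (p + 1) hflt ?_ hLf
  -- the bit graph has polynomial advice
  rw [PPoly_eq_polyAdvice_P_holds]
  obtain ⟨P, hP⟩ := SharpPHT.Core.advice_spec (Q := Q) hχ
  obtain ⟨F, hF, hFs⟩ := SharpPHT.machineFn_codeFP
  -- the `P` language of the machine (one-bit normalised)
  set g : List Bool → List Bool := PPPostBQP.anyTrueF F with hg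
  have hgFP : g ∈ FP := PPPostBQP.anyTrueF_mem_FP hF
  set L' : Language Bool := {w | g w = [true]} with hL'
  have hL'P : L' ∈ Classes.P :=
    mem_P_of_mem_FP hgFP _ fun s => ⟨fun h => h, fun h => by
      have hne : g s ≠ [true] := h
      rw [hg, PPPostBQP.anyTrueF_apply] at hne ⊢
      cases hb : (F s).any id with
      | false => rfl
      | true => rw [hb] at hne; exact absurd rfl hne⟩
  -- the advice table
  set table : ℕ → List SharpPHT.Core.AdvDatum := fun n => List.ofFn fun k : Fin (n + 1) => Q.advOf k with htable
  refine ⟨L', hL'P, fun n => rawE advE (table n), (Polynomial.X + 1) * (2 * P + 2), fun n => ?_, fun z => ?_⟩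
  · -- polynomial length of the table
    refine (BravyiGosset.length_rawE_le_of_forall advE (table n) (P.eval n) fun a ha => ?_).trans ?_
    · rw [htable] at ha
      simp only [List.mem_ofFn] at ha
      obtain ⟨k, rfl⟩ := ha
      exact ((hP k).1).trans (TM2Iter.eval_mono P (Nat.lt_succ_iff.1 k.2))
    · simp [htable]
  · -- correctness
    have hcode : boolPair z (rawE advE (table z.length)) = InE (z, table z.length) := rfl
    have hval : g (boolPair z (rawE advE (table z.length))) = [machineFn (z, table z.length)] := by
      rw [hg, PPPostBQP.anyTrueF_apply, hcode, hFs]; simp [bitE]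
    have hget : (table z.length).getD (fstP z).length SharpPHT.dflt = Q.advOf (fstP z).length := by
      have hlt : (fstP z).length < z.length + 1 := Nat.lt_succ_of_le (length_fstP_le z)
      rw [htable, List.getD_eq_getElem _ _ (by simpa using hlt), List.getElem_ofFn]
    have heval : (Q.advOf (fstP z).length).eval (fstP z) = f (fstP z) := by
      rw [(hP _).2 (fstP z) rfl, hfR]
      unfold SharpPHT.Core.rho
      rw [hQR, hQp]
    show z ∈ bitLang f ↔ g (boolPair z (rawE advE (table z.length))) = [true]
    rw [hval]
    change (f (fstP z)).testBit (sndP z).length = true ↔ _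
    simp only [List.cons.injEq, and_true, SharpPHT.machineFn, hget, heval, Int.toNat_natCast, decide_eq_true_eq,
      Nat.testBit_eq_decide_div_mod_eq]

end Literature.Computability.QuantumComplexity

end
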